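import Summits.AnomalousDissipation.AnomalousDissipation.Theorems.ImpulseGridGridInjectionIdentity
import Summits.AnomalousDissipation.AnomalousDissipation.Theorems.ImpulseGridGridSignsImprintSubtraction

/-!
# Crux `GridSigns` (stmt-AnomalousDissipation-1771), line `SketchIdeator2` — the spatial kick formula

Stub `stub_kickInjectionIdentity` of the skeleton `GridSignsCeilings`: the mean momentum balance
(`meanMomentumBalance_proof`, item stmt-AnomalousDissipation-1773) of a global Leray–Hopf flow
driven by the slab⊗transverse force `Φ•G`, TESTED WITH `H•G` (`H` a smooth `x₀`-profile with
`∂₀H = χ − Φ`, `G` smooth, transverse, `x₀`-invariant and divergence free, so `H•G` is an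
admissible divergence-free test field), followed by the pointwise algebra
`⟪u,(u·∇)(HG)⟫ = c(χ−Φ)⟪G,u⟫ + (χ−Φ)·w₀·⟪G,u⟫ + H⟪w,(w·∇)G⟫`, `w := u − c e₀`, and linearity of
the generalized long-time average `Λ⟨·⟩` on functions that are interval integrable on every
`[0, T]`:

`c·Λ(ΦG,u) = c·Λ(χ⟪G,u⟫) + Λ(χ w₀⟪G,u⟫) − Λ(Φ w₀⟪G,u⟫) + Λ(H⟪w,(w·∇)G⟫) + νΛ(u,Δ(HG)) + ∫ΦH‖G‖²`.

The quadratic slice functionals (`w₀`-moments, `H`-weighted Reynolds stress) are jointly continuous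
functionals `q(x, u(t,x))` of quadratic growth: integrable on `L²` slices and interval integrable
in time along a Leray–Hopf solution (joint measurability + a.e. energy bound). References:
Foias–Manley–Rosa–Temam 2001, Ch. IV §3.1; Doering–Foias 2002, §2.
-/

noncomputable section

-- `Summit.<Summit>.<Problem>` is the tree's mandated summit-side namespace (CONVENTIONS §2); for this
-- single-conjunct summit the two coincide, so the duplicate is deliberate.
set_option linter.dupNamespace false

open MeasureTheory Set Filter Topology
open scoped InnerProductSpace RealInnerProductSpace

namespace Summit.AnomalousDissipation.AnomalousDissipation.Theorems.GridSignsCeilings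

open Literature.Analysis
open Literature.Analysis.FluidPDE Literature.Analysis.FluidPDE.Torus
open Literature.Analysis.FunctionSpaces Literature.Analysis.FunctionSpaces.Torus
open Summit.AnomalousDissipation.AnomalousDissipation.Theses.ImpulseGrid

namespace KickInjection

/-! ### Quadratic slice functionals along a Leray–Hopf solution -/

section Quadratic

variable {d : Type*} [Fintype d] [DecidableEq d]

omit [DecidableEq d] in
/-- A jointly continuous functional `x ↦ q(x, U x)` of quadratic growth in the field,
`|q(x,v)| ≤ K(1 + ‖v‖)²`, is integrable on every `L²` slice `U`. [folklore] -/
theorem integrable_comp_of_sq_growth {q : UnitAddTorus d → EuclideanSpace ℝ d → ℝ}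
    (hq : Continuous (Function.uncurry q)) {K : ℝ} (hK0 : 0 ≤ K)
    (hK : ∀ x v, |q x v| ≤ K * (1 + ‖v‖) ^ 2)
    {U : UnitAddTorus d → EuclideanSpace ℝ d} (hU : MemLp U 2 volume) :
    Integrable (fun x => q x (U x)) volume := by
  have hg : Integrable (fun x => 2 * K * (1 + ‖U x‖ ^ 2)) volume :=
    ((integrable_const (1 : ℝ)).add (hU.integrable_norm_pow two_ne_zero)).const_mul (2 * K)
  refine hg.mono' (hq.comp_aestronglyMeasurable₂ aestronglyMeasurable_id hU.1)
    (ae_of_all _ fun x => ?_)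
  rw [Real.norm_eq_abs]
  refine (hK x (U x)).trans ?_
  nlinarith [mul_nonneg hK0 (sq_nonneg (1 - ‖U x‖))]

/-- Along a global Leray–Hopf solution, the slice integral `s ↦ ∫ q(x, u(s,x)) dx` of a jointly
continuous functional of quadratic growth is interval integrable on every `[0, T]`: it is
a.e.-strongly measurable by the joint measurability of `u` (Fubini) and bounded a.e. by
`2K(1 + ∫‖u(s)‖²) ≤ 2K(1 + C)` (the `L^∞(0,T;L²)` clause). [folklore] -/
theorem intervalIntegrable_integral_comp_of_sq_growth {ν : ℝ}
    {F u₀ : UnitAddTorus d → EuclideanSpace ℝ d} {u : ℝ → UnitAddTorus d → EuclideanSpace ℝ d}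
    (hu : IsGlobalLerayHopf ν (fun _ => F) u₀ u) {q : UnitAddTorus d → EuclideanSpace ℝ d → ℝ}
    (hq : Continuous (Function.uncurry q)) {K : ℝ} (hK0 : 0 ≤ K)
    (hK : ∀ x v, |q x v| ≤ K * (1 + ‖v‖) ^ 2) {T : ℝ} (hT : 0 < T) :
    IntervalIntegrable (fun s => ∫ x, q x (u s x)) volume 0 T := by
  rw [intervalIntegrable_iff_integrableOn_Ioo_of_le hT.le]
  have huT := hu T hT
  obtain ⟨C, -, hC⟩ := huT.exists_integral_norm_sq_le
  have hm : AEStronglyMeasurable (fun p : ℝ × UnitAddTorus d => q p.2 (Function.uncurry u p))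
      ((volume.restrict (Ioo 0 T)).prod volume) :=
    hq.comp_aestronglyMeasurable₂ continuous_snd.aestronglyMeasurable
      huT.aestronglyMeasurable_uncurry
  refine ⟨hm.integral_prod_right', ?_⟩
  refine HasFiniteIntegral.of_bounded (C := 2 * K * (1 + C)) ?_
  filter_upwards [hC, ae_restrict_mem measurableSet_Ioo] with s hs hsI
  have hmem : MemLp (u s) 2 volume := huT.memLp s (Ioo_subset_Icc_self hsI)
  have hg : Integrable (fun x => 2 * K * (1 + ‖u s x‖ ^ 2)) volume :=
    ((integrable_const (1 : ℝ)).add (hmem.integrable_norm_pow two_ne_zero)).const_mul (2 * K)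
  rw [Real.norm_eq_abs]
  calc |∫ x, q x (u s x)| ≤ ∫ x, |q x (u s x)| := abs_integral_le_integral_abs
    _ ≤ ∫ x, 2 * K * (1 + ‖u s x‖ ^ 2) :=
        integral_mono_of_nonneg (ae_of_all _ fun x => abs_nonneg _) hg
          (ae_of_all _ fun x => (hK x (u s x)).trans
            (by nlinarith [mul_nonneg hK0 (sq_nonneg (1 - ‖u s x‖))]))
    _ = 2 * K * (1 + ∫ x, ‖u s x‖ ^ 2) := by
        rw [integral_const_mul, integral_add (integrable_const _)
          (hmem.integrable_norm_pow two_ne_zero)]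
        simp
    _ ≤ 2 * K * (1 + C) := by gcongr

end Quadratic

/-! ### Pointwise algebra of the kick test field `H • G` -/

section Design

variable {Φ χ H a : UnitAddTorus (Fin 3) → ℝ} {G : UnitAddTorus (Fin 3) → EuclideanSpace ℝ (Fin 3)}

/-- **Key pointwise algebra of the kick test field.** For the grid design (`G` smooth,
`x₀`-invariant, transverse `G₀ = 0`; `H` a smooth `x₀`-profile with `∂₀H = χ − Φ`), any
constant `c` and any field `U`, with `W := U − c e₀`:
`⟪U,(U·∇)(H•G)⟫ = (c χ⟪G,U⟫ − c⟪Φ•G,U⟫) + ((χ W₀⟪G,U⟫ − Φ W₀⟪G,U⟫) + H⟪W,(W·∇)G⟫)`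
(Leibniz rule, `DH[U] = U₀(χ−Φ)`, `∂₀G = 0`, and the `e₀`-components of `G`, `DG[·]`
vanish). [folklore] -/
theorem inner_convect_smul_profile (hH : IsSmooth H) (hG : IsSmooth G)
    (hHinv : ∀ (s : UnitAddCircle) (x : UnitAddTorus (Fin 3)),
      H (x + Pi.single (1 : Fin 3) s) = H x ∧ H (x + Pi.single (2 : Fin 3) s) = H x)
    (hGinv : ∀ (s : UnitAddCircle) (x : UnitAddTorus (Fin 3)), G (x + Pi.single (0 : Fin 3) s) = G x)
    (hG0 : ∀ x, G x 0 = 0) (hH' : ∀ x, Torus.partialDeriv 0 H x = χ x - Φ x) (c : ℝ)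
    (U : UnitAddTorus (Fin 3) → EuclideanSpace ℝ (Fin 3)) (x : UnitAddTorus (Fin 3)) :
    ⟪U x, Torus.convect U (fun y => H y • G y) x⟫ =
      (c * (χ x * ⟪G x, U x⟫) - c * ⟪Φ x • G x, U x⟫) +
        ((χ x * ((U x - c • EuclideanSpace.single 0 1 : EuclideanSpace ℝ (Fin 3)) 0 * ⟪G x, U x⟫) -
            Φ x * ((U x - c • EuclideanSpace.single 0 1 : EuclideanSpace ℝ (Fin 3)) 0 * ⟪G x, U x⟫)) +
          H x * ⟪U x - c • EuclideanSpace.single 0 1,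
            Torus.convect (fun y => U y - c • EuclideanSpace.single 0 1) G x⟫) := by
  have hH1 : IsContDiff 1 H := hH.isContDiff (by simp)
  have hG1 : IsContDiff 1 G := hG.isContDiff (by simp)
  have hDG0 : Torus.fderiv G x (EuclideanSpace.single 0 1) = 0 := by
    rw [← partialDeriv_eq_fderiv_apply hG1]
    exact GridInjection.partialDeriv_eq_zero_of_forall_add_single hGinv x
  have hDGc : Torus.fderiv G x (U x) 0 = 0 := GridInjection.fderiv_apply_coord_eq_zero hG1 hG0 x (U x)
  -- `DH(x)[v] = v₀ (χ x − Φ x)` for the `x₀`-profile `H`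
  have hDH : Torus.fderiv H x (U x) = U x 0 * (χ x - Φ x) := by
    have h1 : partialDeriv 1 H x = 0 :=
      GridInjection.partialDeriv_eq_zero_of_forall_add_single (fun s y => (hHinv s y).1) x
    have h2 : partialDeriv 2 H x = 0 :=
      GridInjection.partialDeriv_eq_zero_of_forall_add_single (fun s y => (hHinv s y).2) x
    have h0 : partialDeriv 0 H x = χ x - Φ x := hH' x
    rw [fderiv_apply_eq_sum_partialDeriv hH1, Fin.sum_univ_three, h1, h2, h0]
    simp
  have h0 : (U x - c • EuclideanSpace.single 0 1 : EuclideanSpace ℝ (Fin 3)) 0 = U x 0 - c := by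
    simp
  rw [h0]
  simp only [Torus.convect, map_sub, map_smul,
    Literature.Analysis.FunctionSpaces.Torus.fderiv_smul_apply hH1 hG1, hDH, hDG0, smul_zero,
    sub_zero, inner_add_right, inner_sub_left, real_inner_smul_left, real_inner_smul_right,
    EuclideanSpace.inner_single_left, hDGc, map_one, mul_zero]
  rw [real_inner_comm (U x) (G x)]
  ring

/-! ### The two quadratic functionals of the kick formula: continuity and growth -/

/-- Joint continuity of the `w₀`-moment functional `(x,v) ↦ a(x) (v − c e₀)₀ ⟪G x, v⟫`. [folklore] -/
theorem continuous_uncurry_moment (ha : Continuous a) (hG : Continuous G) (c : ℝ) :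
    Continuous (Function.uncurry fun (x : UnitAddTorus (Fin 3)) (v : EuclideanSpace ℝ (Fin 3)) =>
      a x * ((v - c • EuclideanSpace.single 0 1 : EuclideanSpace ℝ (Fin 3)) 0 * ⟪G x, v⟫)) := by
  rw [Function.uncurry_def]
  fun_prop

/-- Joint continuity of the weighted Reynolds-stress functional
`(x,v) ↦ a(x) ⟪v − c e₀, DG(x)[v − c e₀]⟫` (`DG(x)[w] = ∑ᵢ wᵢ ∂ᵢG(x)`). [folklore] -/
theorem continuous_uncurry_stress (ha : Continuous a) (hG : IsSmooth G) (c : ℝ) :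
    Continuous (Function.uncurry fun (x : UnitAddTorus (Fin 3)) (v : EuclideanSpace ℝ (Fin 3)) =>
      a x * ⟪v - c • EuclideanSpace.single 0 1,
        Torus.fderiv G x (v - c • EuclideanSpace.single 0 1)⟫) := by
  have hG1 : IsContDiff 1 G := hG.isContDiff (by simp)
  have h : (Function.uncurry fun (x : UnitAddTorus (Fin 3)) (v : EuclideanSpace ℝ (Fin 3)) =>
      a x * ⟪v - c • EuclideanSpace.single 0 1,
        Torus.fderiv G x (v - c • EuclideanSpace.single 0 1)⟫) =
      fun p => a p.1 * ⟪p.2 - c • EuclideanSpace.single 0 1,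
        ∑ i, (p.2 - c • EuclideanSpace.single 0 1 : EuclideanSpace ℝ (Fin 3)) i •
          partialDeriv i G p.1⟫ := by
    funext p
    rw [Function.uncurry_def]
    simp only [fderiv_apply_eq_sum_partialDeriv hG1]
  rw [h]
  have hc : ∀ i, Continuous (partialDeriv i G) := fun i => (hG.partialDeriv i).continuous
  fun_prop

/-- `‖v − c e₀‖ ≤ (1 + |c|)(1 + ‖v‖)`. [folklore] -/
theorem norm_sub_smul_single_le (c : ℝ) (v : EuclideanSpace ℝ (Fin 3)) :
    ‖v - c • (EuclideanSpace.single 0 1 : EuclideanSpace ℝ (Fin 3))‖ ≤ (1 + |c|) * (1 + ‖v‖) := by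
  have hv0 := norm_nonneg v
  have hc0 := abs_nonneg c
  calc ‖v - c • (EuclideanSpace.single 0 1 : EuclideanSpace ℝ (Fin 3))‖
      ≤ ‖v‖ + ‖c • (EuclideanSpace.single 0 1 : EuclideanSpace ℝ (Fin 3))‖ := norm_sub_le _ _
    _ = ‖v‖ + |c| := by simp [norm_smul]
    _ ≤ (1 + |c|) * (1 + ‖v‖) := by nlinarith [mul_nonneg hc0 hv0]

/-- Quadratic growth of the `w₀`-moment functional:
`|a(x) (v − c e₀)₀ ⟪G x, v⟫| ≤ Kₐ K_G (1+|c|)² (1+‖v‖)²`. [folklore] -/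
theorem abs_moment_le {Ka KG : ℝ} (hKa0 : 0 ≤ Ka) (hKG0 : 0 ≤ KG) (hKa : ∀ x, ‖a x‖ ≤ Ka)
    (hKG : ∀ x, ‖G x‖ ≤ KG) (c : ℝ) (x : UnitAddTorus (Fin 3)) (v : EuclideanSpace ℝ (Fin 3)) :
    |a x * ((v - c • EuclideanSpace.single 0 1 : EuclideanSpace ℝ (Fin 3)) 0 * ⟪G x, v⟫)| ≤
      Ka * KG * (1 + |c|) ^ 2 * (1 + ‖v‖) ^ 2 := by
  have hv0 := norm_nonneg v
  have hc0 := abs_nonneg c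
  have hB := norm_sub_smul_single_le c v
  have h1 : |(v - c • EuclideanSpace.single 0 1 : EuclideanSpace ℝ (Fin 3)) 0| ≤
      (1 + |c|) * (1 + ‖v‖) := by
    have h := PiLp.norm_apply_le (v - c • EuclideanSpace.single 0 1 : EuclideanSpace ℝ (Fin 3)) 0
    rw [Real.norm_eq_abs] at h
    exact h.trans hB
  have h2 : |⟪G x, v⟫| ≤ KG * ((1 + |c|) * (1 + ‖v‖)) :=
    (abs_real_inner_le_norm _ _).trans
      (mul_le_mul (hKG x) (by nlinarith [mul_nonneg hc0 hv0]) hv0 hKG0)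
  have h3 : |a x| ≤ Ka := by
    rw [← Real.norm_eq_abs]
    exact hKa x
  rw [abs_mul, abs_mul]
  calc |a x| * (|(v - c • EuclideanSpace.single 0 1 : EuclideanSpace ℝ (Fin 3)) 0| * |⟪G x, v⟫|)
      ≤ Ka * (((1 + |c|) * (1 + ‖v‖)) * (KG * ((1 + |c|) * (1 + ‖v‖)))) :=
        mul_le_mul h3 (mul_le_mul h1 h2 (abs_nonneg _) (by positivity)) (by positivity) hKa0
    _ = Ka * KG * (1 + |c|) ^ 2 * (1 + ‖v‖) ^ 2 := by ring

/-- Quadratic growth of the weighted Reynolds-stress functional: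
`|a(x) ⟪v − c e₀, DG(x)[v − c e₀]⟫| ≤ Kₐ D (1+|c|)² (1+‖v‖)²` when `∑ᵢ ‖∂ᵢG‖ ≤ D`. [folklore] -/
theorem abs_stress_le (hG : IsSmooth G) {Ka D : ℝ} (hKa0 : 0 ≤ Ka) (hD0 : 0 ≤ D)
    (hKa : ∀ x, ‖a x‖ ≤ Ka) (hD : ∀ x, ∑ i, ‖partialDeriv i G x‖ ≤ D) (c : ℝ)
    (x : UnitAddTorus (Fin 3)) (v : EuclideanSpace ℝ (Fin 3)) :
    |a x * ⟪v - c • EuclideanSpace.single 0 1,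
        Torus.fderiv G x (v - c • EuclideanSpace.single 0 1)⟫| ≤
      Ka * D * (1 + |c|) ^ 2 * (1 + ‖v‖) ^ 2 := by
  have hB := norm_sub_smul_single_le c v
  have hw0 := norm_nonneg (v - c • (EuclideanSpace.single 0 1 : EuclideanSpace ℝ (Fin 3)))
  have h1 : ‖Torus.fderiv G x (v - c • EuclideanSpace.single 0 1)‖ ≤
      ‖v - c • (EuclideanSpace.single 0 1 : EuclideanSpace ℝ (Fin 3))‖ * D :=
    (norm_fderiv_apply_le (hG.isContDiff (by simp)) x _).trans
      (mul_le_mul_of_nonneg_left (hD x) (norm_nonneg _))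
  have h3 : |a x| ≤ Ka := by
    rw [← Real.norm_eq_abs]
    exact hKa x
  rw [abs_mul]
  calc |a x| * |⟪v - c • EuclideanSpace.single 0 1,
          Torus.fderiv G x (v - c • EuclideanSpace.single 0 1)⟫|
      ≤ Ka * (‖v - c • (EuclideanSpace.single 0 1 : EuclideanSpace ℝ (Fin 3))‖ *
          (‖v - c • (EuclideanSpace.single 0 1 : EuclideanSpace ℝ (Fin 3))‖ * D)) :=
        mul_le_mul h3 ((abs_real_inner_le_norm _ _).trans
          (mul_le_mul_of_nonneg_left h1 (norm_nonneg _))) (abs_nonneg _) hKa0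
    _ ≤ Ka * (((1 + |c|) * (1 + ‖v‖)) * (((1 + |c|) * (1 + ‖v‖)) * D)) := by gcongr
    _ = Ka * D * (1 + |c|) ^ 2 * (1 + ‖v‖) ^ 2 := by ring

end Design

end KickInjection

/-- **Stub S2 (spatial kick formula, unfactorized).** Mean momentum balance tested with `H•G`
(`H` a smooth `x₀`-profile with `∂₀H = χ − Φ`), after the pointwise algebra
`⟪u,(u·∇)(HG)⟫ = H⟪w,(w·∇)G⟫ + (∂₀H)·u₀·⟪G,u⟫`, `u₀ = c + w₀`:
`c·Λ(ΦG,u) = c·Λ(χ⟪G,u⟫) + Λ(χ w₀⟪G,u⟫) − Λ(Φ w₀⟪G,u⟫) + Λ(H⟪w,(w·∇)G⟫) + νΛ(u,Δ(HG)) + ∫ΦH‖G‖²`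
(the last term is the free half-kick `‖G‖²/2` once `∫ΦH = 1/2`, see `stub_slabFactorization`;
card shape-constant-split, deterministic spatial twin of the route's KickLemma). [folklore] -/
theorem stub_kickInjectionIdentity :
    ∀ (Λ : GeneralizedLimit) (ν c : ℝ) (Φ χ H : UnitAddTorus (Fin 3) → ℝ)
      (G : UnitAddTorus (Fin 3) → EuclideanSpace ℝ (Fin 3))
      (u₀ : UnitAddTorus (Fin 3) → EuclideanSpace ℝ (Fin 3))
      (u : ℝ → UnitAddTorus (Fin 3) → EuclideanSpace ℝ (Fin 3)),
      0 < ν → IsSmooth Φ → IsSmooth χ → IsSmooth H → IsSmooth G →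
      (∀ (s : UnitAddCircle) x, H (x + Pi.single (1 : Fin 3) s) = H x ∧ H (x + Pi.single (2 : Fin 3) s) = H x) →
      (∀ (s : UnitAddCircle) x, G (x + Pi.single (0 : Fin 3) s) = G x) → (∀ x, G x 0 = 0) → IsDivFree G →
      (∀ x, Torus.partialDeriv 0 H x = χ x - Φ x) →
      IsGlobalLerayHopf ν (fun _ => fun x => Φ x • G x) u₀ u →
      (∃ C : ℝ, ∀ t : ℝ, 0 ≤ t → kineticEnergy (u t) ≤ C) →
      c * Λ.longTimeAvg (fun t => ∫ x, ⟪Φ x • G x, u t x⟫)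
        = c * Λ.longTimeAvg (fun t => ∫ x, χ x * ⟪G x, u t x⟫)
          + Λ.longTimeAvg (fun t => ∫ x, χ x * ((u t x - c • EuclideanSpace.single 0 1 : EuclideanSpace ℝ (Fin 3)) 0 * ⟪G x, u t x⟫))
          - Λ.longTimeAvg (fun t => ∫ x, Φ x * ((u t x - c • EuclideanSpace.single 0 1 : EuclideanSpace ℝ (Fin 3)) 0 * ⟪G x, u t x⟫))
          + Λ.longTimeAvg (fun t => ∫ x, H x * ⟪u t x - c • EuclideanSpace.single 0 1,
              Torus.convect (fun y => u t y - c • EuclideanSpace.single 0 1) G x⟫)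
          + ν * Λ.longTimeAvg (fun t => ∫ x, ⟪u t x, Torus.laplacian (fun y => H y • G y) x⟫)
          + ∫ x, Φ x * H x * ‖G x‖ ^ 2 := by
  intro Λ ν c Φ χ H G u₀ u hν hΦ hχ hH hG hHinv hGinv hG0 hdivG hH' hu hE
  -- the design
  have hFs : IsSmooth (fun x => Φ x • G x) := hΦ.smul' hG
  have hW : IsSmooth (fun x => H x • G x) := hH.smul' hG
  have hWdiv : IsDivFree (fun x => H x • G x) :=
    GridInjection.isDivFree_smul_of_design hH hG hHinv hG0 hdivG
  have hmem : ∀ t : ℝ, 0 ≤ t → MemLp (u t) 2 volume := fun t ht =>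
    (hu (t + 1) (by linarith)).memLp t ⟨ht, by linarith⟩
  -- bounds on the weights and on `∇G`
  obtain ⟨Kχ, hKχ0, hKχ⟩ := exists_nonneg_forall_norm_le_of_continuous hχ.continuous
  obtain ⟨KΦ, hKΦ0, hKΦ⟩ := exists_nonneg_forall_norm_le_of_continuous hΦ.continuous
  obtain ⟨KH, hKH0, hKH⟩ := exists_nonneg_forall_norm_le_of_continuous hH.continuous
  obtain ⟨KG, hKG0, hKG⟩ := exists_nonneg_forall_norm_le_of_continuous hG.continuous
  obtain ⟨D, hD0, hD⟩ := exists_sum_norm_partialDeriv_le hG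
  -- the three quadratic functionals: continuity and growth
  have hq3c := KickInjection.continuous_uncurry_moment hχ.continuous hG.continuous c
  have hq4c := KickInjection.continuous_uncurry_moment hΦ.continuous hG.continuous c
  have hq5c := KickInjection.continuous_uncurry_stress hH.continuous hG c
  have hq3b := KickInjection.abs_moment_le (G := G) hKχ0 hKG0 hKχ hKG c
  have hq4b := KickInjection.abs_moment_le (G := G) hKΦ0 hKG0 hKΦ hKG c
  have hq5b := KickInjection.abs_stress_le hG hKH0 hD0 hKH hD c
  have hK3 : 0 ≤ Kχ * KG * (1 + |c|) ^ 2 := by positivity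
  have hK4 : 0 ≤ KΦ * KG * (1 + |c|) ^ 2 := by positivity
  have hK5 : 0 ≤ KH * D * (1 + |c|) ^ 2 := by positivity
  -- the mean momentum balance tested with `H • G` (item stmt-AnomalousDissipation-1773)
  have hM := meanMomentumBalance_proof Λ ν (fun x => Φ x • G x) (fun x => H x • G x) u₀ u hν hFs hW
    hWdiv hu hE
  -- the force pairing: the free kick
  have hFW : ∫ x, ⟪Φ x • G x, H x • G x⟫ = ∫ x, Φ x * H x * ‖G x‖ ^ 2 := by
    refine integral_congr_ae (ae_of_all _ fun x => ?_)
    simp only [real_inner_smul_left, real_inner_smul_right, real_inner_self_eq_norm_sq]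
    ring
  -- the pointwise-in-time split of the convective pairing against `H • G`, `t ≥ 0`
  have h1 : ∀ t : ℝ, 0 ≤ t → (∫ x, ⟪u t x, Torus.convect (u t) (fun y => H y • G y) x⟫) =
      (c * (∫ x, χ x * ⟪G x, u t x⟫) - c * ∫ x, ⟪Φ x • G x, u t x⟫) +
        (((∫ x, χ x * ((u t x - c • EuclideanSpace.single 0 1 : EuclideanSpace ℝ (Fin 3)) 0 * ⟪G x, u t x⟫)) -
            ∫ x, Φ x * ((u t x - c • EuclideanSpace.single 0 1 : EuclideanSpace ℝ (Fin 3)) 0 * ⟪G x, u t x⟫)) +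
          ∫ x, H x * ⟪u t x - c • EuclideanSpace.single 0 1,
            Torus.convect (fun y => u t y - c • EuclideanSpace.single 0 1) G x⟫) := by
    intro t ht
    have hU := hmem t ht
    have hi : Integrable (u t) volume := hU.integrable one_le_two
    have i1 : Integrable (fun x => ⟪Φ x • G x, u t x⟫) volume :=
      (integrable_inner_of_continuous hi (hΦ.continuous.smul hG.continuous)).congr
        (ae_of_all _ fun x => real_inner_comm _ _)
    have i2 : Integrable (fun x => χ x * ⟪G x, u t x⟫) volume := by
      refine (integrable_inner_of_continuous hi (hχ.continuous.smul hG.continuous)).congr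
        (ae_of_all _ fun x => ?_)
      show ⟪u t x, χ x • G x⟫ = χ x * ⟪G x, u t x⟫
      rw [real_inner_smul_right, real_inner_comm]
    have i3 : Integrable (fun x => χ x *
        ((u t x - c • EuclideanSpace.single 0 1 : EuclideanSpace ℝ (Fin 3)) 0 * ⟪G x, u t x⟫)) volume :=
      KickInjection.integrable_comp_of_sq_growth hq3c hK3 hq3b hU
    have i4 : Integrable (fun x => Φ x *
        ((u t x - c • EuclideanSpace.single 0 1 : EuclideanSpace ℝ (Fin 3)) 0 * ⟪G x, u t x⟫)) volume :=
      KickInjection.integrable_comp_of_sq_growth hq4c hK4 hq4b hU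
    have i5 : Integrable (fun x => H x * ⟪u t x - c • EuclideanSpace.single 0 1,
        Torus.convect (fun y => u t y - c • EuclideanSpace.single 0 1) G x⟫) volume :=
      KickInjection.integrable_comp_of_sq_growth hq5c hK5 hq5b hU
    have h12 : Integrable (fun x => c * (χ x * ⟪G x, u t x⟫) - c * ⟪Φ x • G x, u t x⟫) volume :=
      (i2.const_mul c).sub (i1.const_mul c)
    have h34 : Integrable (fun x =>
        χ x * ((u t x - c • EuclideanSpace.single 0 1 : EuclideanSpace ℝ (Fin 3)) 0 * ⟪G x, u t x⟫) -
          Φ x * ((u t x - c • EuclideanSpace.single 0 1 : EuclideanSpace ℝ (Fin 3)) 0 * ⟪G x, u t x⟫))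
        volume := i3.sub i4
    have h345 : Integrable (fun x =>
        (χ x * ((u t x - c • EuclideanSpace.single 0 1 : EuclideanSpace ℝ (Fin 3)) 0 * ⟪G x, u t x⟫) -
            Φ x * ((u t x - c • EuclideanSpace.single 0 1 : EuclideanSpace ℝ (Fin 3)) 0 * ⟪G x, u t x⟫)) +
          H x * ⟪u t x - c • EuclideanSpace.single 0 1,
            Torus.convect (fun y => u t y - c • EuclideanSpace.single 0 1) G x⟫) volume := h34.add i5
    rw [integral_congr_ae (ae_of_all _
        (KickInjection.inner_convect_smul_profile hH hG hHinv hGinv hG0 hH' c (u t))),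
      integral_add h12 h345, integral_sub (i2.const_mul c) (i1.const_mul c),
      integral_const_mul, integral_const_mul, integral_add h34 i5, integral_sub i3 i4]
  -- interval integrability on `[0, T]` of the five pieces
  have hA1 : ∀ T, 0 < T → IntervalIntegrable (fun t => ∫ x, ⟪Φ x • G x, u t x⟫) volume 0 T := by
    intro T hT
    have h := GridInjection.intervalIntegrable_inner hu (hΦ.continuous.smul hG.continuous) hT
    refine (h.congr fun t _ => ?_)
    exact integral_congr_ae (ae_of_all _ fun x => real_inner_comm _ _)
  have hA2 : ∀ T, 0 < T → IntervalIntegrable (fun t => ∫ x, χ x * ⟪G x, u t x⟫) volume 0 T := by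
    intro T hT
    have h := GridInjection.intervalIntegrable_inner hu (hχ.continuous.smul hG.continuous) hT
    refine (h.congr fun t _ => ?_)
    refine integral_congr_ae (ae_of_all _ fun x => ?_)
    show ⟪u t x, χ x • G x⟫ = χ x * ⟪G x, u t x⟫
    rw [real_inner_smul_right, real_inner_comm]
  have hA3 : ∀ T, 0 < T → IntervalIntegrable (fun t => ∫ x, χ x *
      ((u t x - c • EuclideanSpace.single 0 1 : EuclideanSpace ℝ (Fin 3)) 0 * ⟪G x, u t x⟫)) volume 0 T :=
    fun T hT => KickInjection.intervalIntegrable_integral_comp_of_sq_growth hu hq3c hK3 hq3b hT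
  have hA4 : ∀ T, 0 < T → IntervalIntegrable (fun t => ∫ x, Φ x *
      ((u t x - c • EuclideanSpace.single 0 1 : EuclideanSpace ℝ (Fin 3)) 0 * ⟪G x, u t x⟫)) volume 0 T :=
    fun T hT => KickInjection.intervalIntegrable_integral_comp_of_sq_growth hu hq4c hK4 hq4b hT
  have hA5 : ∀ T, 0 < T → IntervalIntegrable (fun t => ∫ x, H x * ⟪u t x - c • EuclideanSpace.single 0 1,
      Torus.convect (fun y => u t y - c • EuclideanSpace.single 0 1) G x⟫) volume 0 T :=
    fun T hT => KickInjection.intervalIntegrable_integral_comp_of_sq_growth hu hq5c hK5 hq5b hT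
  have hT12 : ∀ T, 0 < T → IntervalIntegrable
      (fun t => c * (∫ x, χ x * ⟪G x, u t x⟫) - c * ∫ x, ⟪Φ x • G x, u t x⟫) volume 0 T :=
    fun T hT => ((hA2 T hT).const_mul c).sub ((hA1 T hT).const_mul c)
  have hT34 : ∀ T, 0 < T → IntervalIntegrable (fun t =>
      (∫ x, χ x * ((u t x - c • EuclideanSpace.single 0 1 : EuclideanSpace ℝ (Fin 3)) 0 * ⟪G x, u t x⟫)) -
        ∫ x, Φ x * ((u t x - c • EuclideanSpace.single 0 1 : EuclideanSpace ℝ (Fin 3)) 0 * ⟪G x, u t x⟫))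
      volume 0 T :=
    fun T hT => (hA3 T hT).sub (hA4 T hT)
  have hT345 : ∀ T, 0 < T → IntervalIntegrable (fun t =>
      ((∫ x, χ x * ((u t x - c • EuclideanSpace.single 0 1 : EuclideanSpace ℝ (Fin 3)) 0 * ⟪G x, u t x⟫)) -
          ∫ x, Φ x * ((u t x - c • EuclideanSpace.single 0 1 : EuclideanSpace ℝ (Fin 3)) 0 * ⟪G x, u t x⟫)) +
        ∫ x, H x * ⟪u t x - c • EuclideanSpace.single 0 1,
          Torus.convect (fun y => u t y - c • EuclideanSpace.single 0 1) G x⟫) volume 0 T :=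
    fun T hT => (hT34 T hT).add (hA5 T hT)
  -- linearity of the generalized long-time average
  have hsplit : Λ.longTimeAvg (fun t => ∫ x, ⟪u t x, Torus.convect (u t) (fun y => H y • G y) x⟫) =
      (c * Λ.longTimeAvg (fun t => ∫ x, χ x * ⟪G x, u t x⟫) -
          c * Λ.longTimeAvg (fun t => ∫ x, ⟪Φ x • G x, u t x⟫)) +
        ((Λ.longTimeAvg (fun t => ∫ x, χ x * ((u t x - c • EuclideanSpace.single 0 1 : EuclideanSpace ℝ (Fin 3)) 0 * ⟪G x, u t x⟫)) -
            Λ.longTimeAvg (fun t => ∫ x, Φ x * ((u t x - c • EuclideanSpace.single 0 1 : EuclideanSpace ℝ (Fin 3)) 0 * ⟪G x, u t x⟫))) +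
          Λ.longTimeAvg (fun t => ∫ x, H x * ⟪u t x - c • EuclideanSpace.single 0 1,
              Torus.convect (fun y => u t y - c • EuclideanSpace.single 0 1) G x⟫)) := by
    rw [Λ.longTimeAvg_congr (fun t ht => h1 t ht.le), GridInjection.longTimeAvg_add Λ hT12 hT345,
      GridInjection.longTimeAvg_sub Λ (fun T hT => (hA2 T hT).const_mul c)
        (fun T hT => (hA1 T hT).const_mul c),
      GridInjection.longTimeAvg_const_mul, GridInjection.longTimeAvg_const_mul,
      GridInjection.longTimeAvg_add Λ hT34 hA5, GridInjection.longTimeAvg_sub Λ hA3 hA4]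
  rw [hsplit, hFW] at hM
  linarith

end Summit.AnomalousDissipation.AnomalousDissipation.Theorems.GridSignsCeilings

end
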